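import Summits.KontsevichZagierPeriods.KontsevichZagierPeriods.Theorems.FermatIsogenyBetaProductSectorStubTwinDupStepRightChain
import Summits.KontsevichZagierPeriods.KontsevichZagierPeriods.Theorems.FermatIsogenyBetaProductSectorDefs

/-!
# `BetaProductSector` (stmt-KontsevichZagierPeriods-3898), line `registered` (v3) — stub `stub_twinDupStep`,
# part 7: the twin-duplication move X9

THE REFLECTION-FREE TWIN-DUPLICATION MOVE "X9" of the line (Legendre's duplication `Γ(2x)√π = 2^{2x-1}Γ(x)Γ(x+½)`,
Andrews–Askey–Roy 1999 Thm 1.5.1, applied at `a` against its application at `b`):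

  `B(a+b-½, b+½) · B(b, a+½-b) = 4^{a-b} · B(a+b-½, a+½-b) · B(a, 2b)`     (`0 < b`, `½ < a+b`, `b < a+½`),

realised INSIDE the Kontsevich–Zagier calculus of moves (Kontsevich–Zagier 2001 §1.2, rules (1), (2) only) between
the pinned representations `r = [(0,1)², κ x^{a+b-3/2}(1-x)^{b-½} y^{b-1}(1-y)^{a-b-½}]` and
`r' = [(0,1)², κ4^{a-b} x^{a+b-3/2}(1-x)^{a-b-½} y^{a-1}(1-y)^{2b-1}]`, uniformly in a real-algebraic weight `κ` and
WITHOUT cancellation. In the Mellin coordinates `(P,Q)` (`P^{a-1}Q^{b-½}` the common integrand up to Jacobians: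
`P = x(1-y)`, `Q = x(1-x)y/(1-y)` on the left, `P = 4x(1-x)y`, `Q = x(1-y)²/(4(1-x))` on the right) both boxes are
twofold covers of one region; writing `s = √(x/(1-x))` on the right, the four roots of the quartic
`s⁴ - (4/P-2)s² + (8√Q/P)s + 1` over a Mellin point are the two right preimages `s, s' > 0` and two negative
roots `-n > -n'`, and the left preimages correspond to the two MIXED pairs `{-n, s}`, `{-n, s'}` (the left cubic
is a resolvent of the right quartic: its root is `4ns/(1+ns)²`). Both boxes are therefore RATIONAL images of the
common PARAMETER TRIANGLE `Ω = {(t,m) = (n², ns) | 0 < t < m < 1}`: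

* the LEFT chain (part 4, `TwinDupStep.twin_left_chain`): the chart `λ(t,m) = (t(1+m)²/D̂, ((1-m)/(1+m))²)`,
  `D̂ = m(m-t)² + t(1+m)²`, gives `[Ω, ℓ]`, `ℓ = 2·pre·2m(m²-t²)`,
  `pre = (4mt)^{a-1}(4t(m-t)(1-m²))^{2b-1}(64t)^{½-b}D̂^{-a-2b}` (`P = 4mt/D̂`);
* the RIGHT chain (part 6, `TwinDupStep.twin_right_chain`, the BRANCH EXCHANGE): the right box is `[Ω, r]`,
  `r = 2·pre·t(1+m²-2mt)`, along `κ(x,m) = (m²(1-x)/x, m)` and `ρ(x,m) = (x, m/D̃)`; the ghost term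
  `ℓ - r = 2·pre·c`, `c = 2m³ - tm² - t = -(D̂²/4t)·∂P/∂m`, changes sign across the critical curve of the fibre
  function `m ↦ P(t,m)`, and the ghost chart `(t,m) ↦ (t,P)` (part 3) carries `[Ω₊, 2·pre·c]` and `[Ω₋, -2·pre·c]`
  onto ONE representation on the common image of the two laps, so the ghost terms cancel (rules (1a), (1b), (2));
* scaling by `κ` (`KZ.Equivalent.constMul`) and pinning (rule (1)) as in the landed QUAD and DD moves.

All intermediate representations are constructed. Everything is proved; no `def`, no named fact.

References: Kontsevich–Zagier 2001 §1.2; Andrews–Askey–Roy 1999 Thm 1.5.1.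
-/

noncomputable section

open MeasureTheory Set
open Literature.ModelTheory.ExponentialFields (IsSemialgebraic)
open MvPolynomial (aeval X C)

namespace Summit.KontsevichZagierPeriods.FermatIsogeny.BetaProductSectorStubs

open Literature.NumberTheory.Transcendental
open Literature.NumberTheory.Transcendental.KZ

open QuadStep DirichletReassoc TwinDupStep in
/-- **Stub `stub_twinDupStep` — THE TWIN-DUPLICATION MOVE "X9"** (an instance of the line's `stub_uniformStep`):
the Beta-product identity `B(a+b-½, b+½)·B(b, a+½-b) = 4^{a-b}·B(a+b-½, a+½-b)·B(a, 2b)` — Legendre's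
duplication (Andrews–Askey–Roy 1999, Thm 1.5.1) at `a` against Legendre's duplication at `b` — realised as a chain
of moves of the Kontsevich–Zagier calculus between the pinned representations
`[(0,1)², κ x^{a+b-3/2}(1-x)^{b-½}y^{b-1}(1-y)^{a-b-½}]` and
`[(0,1)², κ4^{a-b} x^{a+b-3/2}(1-x)^{a-b-½}y^{a-1}(1-y)^{2b-1}]`, uniformly in the real-algebraic weight `κ` and without cancellation: the unweighted left box as a box-Mellin
member, the left chain onto the parameter triangle `Ω` (`TwinDupStep.twin_left_chain`), the right chain with its
branch exchange back to the weighted right box (`TwinDupStep.twin_right_chain`), scaling by `κ`, pinning (rule 1).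
[cite: AndrewsAskeyRoy1999, Thm 1.5.1] -/
theorem stub_twinDupStep : ∀ (a b : ℚ) (κ : ℝ), 0 < b → 1 / 2 < a + b → b < a + 1 / 2 → IsAlgebraic ℚ κ → ∀ (r r' : Literature.NumberTheory.Transcendental.KZ.IntegralRep 2), Summit.KontsevichZagierPeriods.FermatIsogeny.BetaProductSectorDefs.IsPinned (a + b - 1 / 2) (b + 1 / 2) b (a + 1 / 2 - b) κ r → Summit.KontsevichZagierPeriods.FermatIsogeny.BetaProductSectorDefs.IsPinned (a + b - 1 / 2) (a + 1 / 2 - b) a (2 * b) (κ * (4:ℝ) ^ ((a:ℝ) - b)) r' → Literature.NumberTheory.Transcendental.KZ.Equivalent r r' := by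
  intro a b κ hb hab hba hκ r r' hr hr'
  obtain ⟨hrd, hri⟩ := hr
  obtain ⟨hr'd, hr'i⟩ := hr'
  have hA : 0 < a + b - 1 / 2 := by linarith
  have hB : 0 < b + 1 / 2 := by linarith
  have hE : 0 < a + 1 / 2 - b := by linarith
  -- (1) the unweighted left box as a box-Mellin member
  have hint := integrableOn_betaBox (a + b - 1 / 2) (b + 1 / 2) b (a + 1 / 2 - b) 1 hA hB hb hE
  rw [show (a + b - 1 / 2 - 1 : ℚ) = a + b - 3 / 2 by ring, show (b + 1 / 2 - 1 : ℚ) = b - 1 / 2 by ring,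
    show (a + 1 / 2 - b - 1 : ℚ) = a - b - 1 / 2 by ring] at hint
  obtain ⟨U, hU⟩ := (KZ.exists_isMellinMemberWith_iff _ _ _).2 hint
  -- (2) the left chain onto the parameter triangle and the right chain back to the weighted right box
  obtain ⟨L, hLd, hLi, eUL⟩ := twin_left_chain a b U hU
  obtain ⟨R, hRd, hRi, eLR⟩ := twin_right_chain a b hb hab hba L hLd hLi
  -- (3) scale the unweighted chain by `κ` and pin `r`, `r'` to its ends
  have hsc : KZ.Equivalent (U.constMul κ hκ) (R.constMul κ hκ) := KZ.Equivalent.constMul κ hκ (eUL.trans eLR)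
  have hrU : KZ.Equivalent r (U.constMul κ hκ) := by
    refine equivalent_constMul_of_eqOn κ hκ r U (hU.1.trans (mellinBox_betaBox.trans hrd.symm))
      (f := fun z => (z 0) ^ (((a + b - 1 / 2 : ℚ):ℝ) - 1) * (1 - z 0) ^ (((b + 1 / 2 : ℚ):ℝ) - 1) *
        (z 1) ^ ((b:ℝ) - 1) * (1 - z 1) ^ (((a + 1 / 2 - b : ℚ):ℝ) - 1)) (fun z hz => ?_) (fun z hz => ?_)
    · rw [hri hz]
      simp only [mul_assoc]
    · rw [hU.2 hz, mellin_betaBox_apply]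
      simp only [Matrix.cons_val_zero, Matrix.cons_val_one, Matrix.cons_val]
      push_cast
      rw [show ((a:ℝ) + b - 1 / 2 - 1) = (a:ℝ) + b - 3 / 2 by ring, show ((b:ℝ) + 1 / 2 - 1) = (b:ℝ) - 1 / 2 by ring,
        show ((a:ℝ) + 1 / 2 - b - 1) = (a:ℝ) - b - 1 / 2 by ring]
      ring
  have hr'R : KZ.Equivalent r' (R.constMul κ hκ) := by
    refine equivalent_constMul_of_eqOn κ hκ r' R (hRd.trans hr'd.symm)
      (f := fun z => (4:ℝ) ^ ((a:ℝ) - b) * (z 0) ^ ((a:ℝ) + b - 1 / 2 - 1) * (1 - z 0) ^ ((a:ℝ) + 1 / 2 - b - 1) *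
        (z 1) ^ ((a:ℝ) - 1) * (1 - z 1) ^ (2 * (b:ℝ) - 1)) (fun z hz => ?_) hRi
    rw [hr'i hz]
    push_cast
    ring
  exact hrU.trans (hsc.trans hr'R.symm)

end Summit.KontsevichZagierPeriods.FermatIsogeny.BetaProductSectorStubs

end
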